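import Literature.MathematicalPhysics.QuantumFieldTheory.ConformalBootstrap3D.BlockSignedRadialExpansion
import Literature.MathematicalPhysics.QuantumFieldTheory.ConformalBootstrap3D.RadialExistenceOfPositivity
import Mathlib.LinearAlgebra.FiniteDimensional.Basic
import Mathlib.LinearAlgebra.Matrix.ToLin
import HarnessLib

/-!
# The radial table of the `⟨εσσε⟩` block EXISTS as an explicit object; the radial block clause is
# equivalent to its entrywise non-negativity (Hogervorst–Rychkov 2013 §3 "first method", existence half)

Hogervorst–Rychkov 2013 §3 determine the radial (Gegenbauer) coefficients `B_{n,j}` of a block "by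
converting from the old expansion": substitute `z = 4ρ/(1+ρ)²` into the `z`-series and re-expand; the
degree-`2N` part of the resulting double power series in `(√ρ, √ρ̄)` is a combination of the finitely many
polynomials `(su)^{N-j} 𝒫_j(s²,u²)`, `j ≤ N` (their eq. (3.6)), and the coefficients of that combination
are the `B_{N-ℓ, j}`. In the tree the conversion array is `zRhoConv` (`RadialConversion`) and the
IDENTIFICATION half is proved (`IsConformalBlock3D.radialMonArr_eq_zRhoConv`: any radial table of a typed
conjugate-pair block has monomial array `zRhoConv`), but no table was constructed. This file supplies
the EXISTENCE half — elementary linear algebra — and draws the consequence for the `σ–ε` radial clause: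

* `zRhoConv_swap`, `zRhoConv_eq_zero_of_odd_sum`, `zRhoConv_eq_zero_of_lt` — the conversion array is
  symmetric and lives on even total degrees `≥ 2ℓ`;
* `exists_sum_radialArr_eq` — on the antidiagonal `a + b = 2N` the `N + 1` arrays `radialArr N j`,
  `j ≤ N`, span all symmetric arrays (they are linearly independent by `eq_zero_of_sum_radialArr_eq_zero`,
  and the space of symmetric arrays has dimension `N + 1`; `LinearMap.injective_iff_surjective`);
* `radialTableOf ℓ Z` — a supported table with prescribed monomial array `Z` (any symmetric `Z` living on
  even degrees `≥ 2ℓ`): `radialMonArr_radialTableOf`;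
* `radialTableAB s Δ ℓ` — THE radial table of the prefactored `⟨εσσε⟩` block `v^{s/2} g^{-s,s}_{Δ,ℓ}`
  (`s = Δσ - Δε`): `radialMonArr ℓ (radialTableAB s Δ ℓ) = zRhoConv (s/2) Δ ℓ (A^{(s/2,s/2)}/λ_ℓ)`; any
  radial table of a typed `⟨εσσε⟩` block IS this one (`IsConformalBlock3D.radialTable_eq_radialTableAB`);
* `hasRadialExpansion_of_radialTableAB_nonneg` — if the table is entrywise `≥ 0` then the typed block HAS
  the radial expansion on the whole square (Vivanti–Pringsheim, `RadialExistenceOfPositivity`);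
* **`radialPairClause_iff_radialTableAB_nonneg`** — at a regular `(Δ, ℓ)` strictly above the unitarity
  bound, `RadialPairClause Δσ Δε Δ ℓ ↔ ∀ (m,j), 0 ≤ radialTableAB (Δσ-Δε) Δ ℓ (m,j)`: the would-be
  radial block clause A2ρ of pub-ising3d is EXACTLY Hogervorst–Rychkov's / Costa–Hansen–Penedones–
  Trevisani's statement "the radial coefficients are non-negative" for one explicitly defined table
  (with `BlockSignedRadialExpansion` for the signed `⟨σεσε⟩` half).

Nothing here proves that non-negativity (in print it is the unitarity of the `⟨εσσε⟩` radial
quantisation: CHPT16 §2.1, Kravchuk–Qiao–Rychkov 2020 §4.1–4.2); no named fact is introduced.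

Sources: M. Hogervorst, S. Rychkov, Phys. Rev. D 87 (2013) 106004, arXiv:1303.1111, §3 eqs. (3.4)–(3.6)
and the "first method" paragraph, §3.1; M. S. Costa, T. Hansen, J. Penedones, E. Trevisani,
JHEP 07 (2016) 057, arXiv:1603.05552, §2.1 eqs. (2.11), (2.15). Tree: `radialArr`, `radialMonArr`,
`eq_zero_of_sum_radialArr_eq_zero`, `RadialSupport.eq_of_radialMonArr_eq`, `zRhoConv`, `convCoeff`,
`convDeg`, `IsConformalBlock3D.radialMonArr_eq_zRhoConv`, `hasRadialExpansion_of_table_nonneg`,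
`radialPairClause_of_hasRadialExpansion`. Mathlib: `Matrix.mulVecLin`, `LinearMap.injective_iff_surjective`.
-/

namespace Literature.MathematicalPhysics.QuantumFieldTheory.ConformalBootstrap3D

open Finset Set

/-! ### §1. Symmetry and support of the conversion array -/

/-- The swap `((n,j),((i,k),(t,t'))) ↦ ((n,j),((k,i),(t',t)))` of conversion indices (exchange of the two
variables `s ↔ u`). [cite: HogervorstRychkov2013, §3 "first method"] -/
def convSwap (τ : ConvIndex) : ConvIndex := (τ.1, ((τ.2.1.2, τ.2.1.1), (τ.2.2.2, τ.2.2.1)))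

/-- `convSwap` is an involution. [cite: HogervorstRychkov2013, §3 "first method"] -/
theorem convSwap_convSwap (τ : ConvIndex) : convSwap (convSwap τ) = τ := by
  obtain ⟨⟨n, j⟩, ⟨i, k⟩, ⟨t, t'⟩⟩ := τ
  rfl

/-- The degree of the swapped index is the swapped degree. [cite: HogervorstRychkov2013, §3 "first method"] -/
theorem convDeg_convSwap (ℓ : ℕ) (τ : ConvIndex) : convDeg ℓ (convSwap τ) = (convDeg ℓ τ).swap := by
  obtain ⟨⟨n, j⟩, ⟨i, k⟩, ⟨t, t'⟩⟩ := τ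
  rfl

/-- The conversion coefficient is swap-invariant (`λ_iλ_k` and the two binomial factors are exchanged).
[cite: HogervorstRychkov2013, §3 "first method"] -/
theorem convCoeff_convSwap (c Δ : ℝ) (ℓ : ℕ) (A : ℕ × ℕ → ℝ) (τ : ConvIndex) :
    convCoeff c Δ ℓ A (convSwap τ) = convCoeff c Δ ℓ A τ := by
  obtain ⟨⟨n, j⟩, ⟨i, k⟩, ⟨t, t'⟩⟩ := τ
  unfold convCoeff convSwap
  simp only
  by_cases h : i + k = j
  · rw [if_pos (by omega : k + i = j), if_pos h]
    ring
  · rw [if_neg (by omega : ¬ k + i = j), if_neg h]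

/-- **The conversion array is symmetric**: `zRhoConv (b,a) = zRhoConv (a,b)` (the block is symmetric in
`z ↔ z̄`, i.e. `ρ ↔ ρ̄`). [cite: HogervorstRychkov2013, §3 "first method"] -/
theorem zRhoConv_swap (c Δ : ℝ) (ℓ : ℕ) (A : ℕ × ℕ → ℝ) (a b : ℕ) :
    zRhoConv c Δ ℓ A (b, a) = zRhoConv c Δ ℓ A (a, b) := by
  unfold zRhoConv
  let e : ↥(convDeg ℓ ⁻¹' {(a, b)}) ≃ ↥(convDeg ℓ ⁻¹' {(b, a)}) :=
    { toFun := fun τ => ⟨convSwap τ.1, by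
        have h : convDeg ℓ τ.1 = (a, b) := τ.2
        show convDeg ℓ (convSwap τ.1) ∈ ({(b, a)} : Set (ℕ × ℕ))
        rw [Set.mem_singleton_iff, convDeg_convSwap, h, Prod.swap_prod_mk]⟩
      invFun := fun τ => ⟨convSwap τ.1, by
        have h : convDeg ℓ τ.1 = (b, a) := τ.2
        show convDeg ℓ (convSwap τ.1) ∈ ({(a, b)} : Set (ℕ × ℕ))
        rw [Set.mem_singleton_iff, convDeg_convSwap, h, Prod.swap_prod_mk]⟩
      left_inv := fun τ => Subtype.ext (convSwap_convSwap τ.1)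
      right_inv := fun τ => Subtype.ext (convSwap_convSwap τ.1) }
  rw [← e.tsum_eq]
  exact tsum_congr fun τ => convCoeff_convSwap c Δ ℓ A τ.1

/-- A conversion index in the fibre of `(a,b)` has `a + b` even. [cite: HogervorstRychkov2013, §3 "first method"] -/
theorem even_of_convDeg_eq {ℓ : ℕ} {τ : ConvIndex} {a b : ℕ} (h : convDeg ℓ τ = (a, b)) :
    (a + b) % 2 = 0 := by
  obtain ⟨⟨n, j⟩, ⟨i, k⟩, ⟨t, t'⟩⟩ := τ
  unfold convDeg convOffset at h
  simp only [Prod.mk.injEq] at h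
  omega

/-- **The conversion array vanishes at odd total degree** (its fibre is empty).
[cite: HogervorstRychkov2013, §3 eq. (3.6)] -/
theorem zRhoConv_eq_zero_of_odd_sum (c Δ : ℝ) (ℓ : ℕ) (A : ℕ × ℕ → ℝ) {a b : ℕ}
    (h : (a + b) % 2 = 1) : zRhoConv c Δ ℓ A (a, b) = 0 := by
  unfold zRhoConv
  haveI : IsEmpty ↥(convDeg ℓ ⁻¹' {(a, b)}) := ⟨fun τ => by
    have hτ : convDeg ℓ τ.1 = (a, b) := τ.2
    have := even_of_convDeg_eq hτ
    omega⟩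
  exact tsum_empty

/-- **The conversion array vanishes below total degree `2ℓ`** (every coefficient in the fibre carries the
Legendre constraint `i + k = j`, which forces degree `≥ 2(ℓ+n)`). [cite: HogervorstRychkov2013, §3 eq. (3.6)] -/
theorem zRhoConv_eq_zero_of_lt (c Δ : ℝ) (ℓ : ℕ) (A : ℕ × ℕ → ℝ) {a b : ℕ} (h : a + b < 2 * ℓ) :
    zRhoConv c Δ ℓ A (a, b) = 0 := by
  unfold zRhoConv
  have hzero : ∀ τ : ↥(convDeg ℓ ⁻¹' {(a, b)}), convCoeff c Δ ℓ A τ.1 = 0 := by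
    intro τ
    have hτ : convDeg ℓ τ.1 = (a, b) := τ.2
    obtain ⟨⟨⟨n, j⟩, ⟨i, k⟩, ⟨t, t'⟩⟩, _⟩ := τ
    unfold convDeg convOffset at hτ
    simp only [Prod.mk.injEq] at hτ
    unfold convCoeff
    simp only
    rw [if_neg]
    intro hik
    omega
  rw [tsum_congr hzero, tsum_zero]

/-! ### §2. Linear algebra on one antidiagonal: the `radialArr N j`, `j ≤ N`, span the symmetric arrays -/

/-- `radialArr` is symmetric under `(a,b) ↦ (b,a)`. [cite: HogervorstRychkov2013, §3 eq. (3.6)] -/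
theorem radialArr_swap (N j a b : ℕ) : radialArr N j (b, a) = radialArr N j (a, b) := by
  unfold radialArr
  simp only
  by_cases h : j ≤ N ∧ N - j ≤ a ∧ N - j ≤ b ∧ a + b = 2 * N ∧ (a - (N - j)) % 2 = 0
  · obtain ⟨h1, h2, h3, h4, h5⟩ := h
    rw [if_pos ⟨h1, h3, h2, by omega, by omega⟩, if_pos ⟨h1, h2, h3, h4, h5⟩, mul_comm]
  · rw [if_neg h, if_neg]
    rintro ⟨h1, h2, h3, h4, h5⟩
    exact h ⟨h1, h3, h2, by omega, by omega⟩

/-- **Existence of the spin coefficients within a level.** For every array `Z` symmetric on the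
antidiagonal `a + b = 2N` there are coefficients `c_0, …, c_N` with `Σ_{j ≤ N} c_j · radialArr N j = Z` on
that antidiagonal: the `N + 1` arrays `radialArr N j` are linearly independent there
(`eq_zero_of_sum_radialArr_eq_zero`) and the symmetric arrays form a space of dimension `N + 1`
(Hogervorst–Rychkov 2013 §3 "first method": the degree-`2N` part of the converted series "can be
expressed" in the `𝒫_{N,j}`). [cite: HogervorstRychkov2013, §3 eqs. (3.4)–(3.6)] -/
theorem exists_sum_radialArr_eq (N : ℕ) (Z : ℕ × ℕ → ℝ)
    (hZ : ∀ a b : ℕ, a + b = 2 * N → Z (b, a) = Z (a, b)) :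
    ∃ c : ℕ → ℝ, ∀ p ∈ antidiagonal (2 * N), ∑ j ∈ range (N + 1), c j * radialArr N j p = Z p := by
  classical
  -- the square matrix of the corner block `a ≤ N`
  let M : Matrix (Fin (N + 1)) (Fin (N + 1)) ℝ := fun a j => radialArr N j ((a : ℕ), 2 * N - (a : ℕ))
  have hinj : Function.Injective (Matrix.mulVecLin M) := by
    intro v v' hvv
    have h0 : Matrix.mulVecLin M (v - v') = 0 := by rw [map_sub, hvv, sub_self]
    -- the combination with coefficients `v - v'` vanishes on the whole antidiagonal
    set c : ℕ → ℝ := fun j => if h : j < N + 1 then (v - v') ⟨j, h⟩ else 0 with hc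
    have hrow : ∀ a : ℕ, a ≤ N →
        ∑ j ∈ range (N + 1), c j * radialArr N j (a, 2 * N - a) = 0 := by
      intro a ha
      have h1 := congrFun h0 ⟨a, by omega⟩
      rw [Matrix.mulVecLin_apply] at h1
      simp only [Matrix.mulVec, dotProduct, Pi.zero_apply] at h1
      rw [Finset.sum_range]
      rw [← h1]
      refine Finset.sum_congr rfl fun j _ => ?_
      simp only [hc, dif_pos j.2, M]
      ring
    have hall : ∀ p ∈ antidiagonal (2 * N), ∑ j ∈ range (N + 1), c j * radialArr N j p = 0 := by
      intro p hp
      obtain ⟨a, b⟩ := p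
      rw [mem_antidiagonal] at hp
      simp only at hp
      rcases le_or_gt a N with ha | ha
      · have := hrow a ha
        rwa [show 2 * N - a = b by omega] at this
      · have hb : b ≤ N := by omega
        have := hrow b hb
        rw [show 2 * N - b = a by omega] at this
        rw [← this]
        exact Finset.sum_congr rfl fun j _ => by rw [radialArr_swap N j b a]
    have hc0 := eq_zero_of_sum_radialArr_eq_zero N c hall
    have : v - v' = 0 := by
      funext j
      have := hc0 j (by omega : (j : ℕ) ≤ N)
      simp only [hc, dif_pos j.2] at this
      exact this
    exact sub_eq_zero.mp this
  have hsurj : Function.Surjective (Matrix.mulVecLin M) :=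
    LinearMap.injective_iff_surjective.mp hinj
  obtain ⟨v, hv⟩ := hsurj fun a => Z ((a : ℕ), 2 * N - (a : ℕ))
  refine ⟨fun j => if h : j < N + 1 then v ⟨j, h⟩ else 0, fun p hp => ?_⟩
  obtain ⟨a, b⟩ := p
  rw [mem_antidiagonal] at hp
  simp only at hp
  -- the corner rows `a ≤ N` are the matrix identity; the others follow by symmetry
  have hrow : ∀ a : ℕ, a ≤ N → ∑ j ∈ range (N + 1),
      (fun j => if h : j < N + 1 then v ⟨j, h⟩ else 0) j * radialArr N j (a, 2 * N - a) =
        Z (a, 2 * N - a) := by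
    intro a ha
    have h1 := congrFun hv ⟨a, by omega⟩
    rw [Matrix.mulVecLin_apply] at h1
    simp only [Matrix.mulVec, dotProduct] at h1
    rw [Finset.sum_range, ← h1]
    refine Finset.sum_congr rfl fun j _ => ?_
    simp only [dif_pos j.2, M]
    ring
  rcases le_or_gt a N with ha | ha
  · have := hrow a ha
    rwa [show 2 * N - a = b by omega] at this
  · have hb : b ≤ N := by omega
    have := hrow b hb
    rw [show 2 * N - b = a by omega] at this
    rw [← hZ a b hp, ← this]
    exact Finset.sum_congr rfl fun j _ => by rw [radialArr_swap N j b a]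

/-! ### §3. A supported table with prescribed monomial array -/

/-- **The radial table with prescribed monomial array `Z`**: at level `m` the spin coefficients solving
`Σ_{j ≤ ℓ+m} w(m,j) radialArr (ℓ+m) j = Z` on the antidiagonal of degree `2(ℓ+m)` (chosen by
`Classical.epsilon`; they exist for symmetric `Z` and are unique by `RadialSupport.eq_of_radialMonArr_eq`),
and `0` off the support `j ≤ ℓ + m` — the "first method" of Hogervorst–Rychkov 2013 §3 as a definition.
[cite: HogervorstRychkov2013, §3 "first method"] -/
noncomputable def radialTableOf (ℓ : ℕ) (Z : ℕ × ℕ → ℝ) (q : ℕ × ℕ) : ℝ :=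
  if q.2 ≤ ℓ + q.1 then
    Classical.epsilon (fun c : ℕ → ℝ => ∀ p ∈ antidiagonal (2 * (ℓ + q.1)),
      ∑ j ∈ range (ℓ + q.1 + 1), c j * radialArr (ℓ + q.1) j p = Z p) q.2
  else 0

/-- The constructed table is supported on `j ≤ ℓ + m`. [cite: HogervorstRychkov2013, §3 eq. (3.5)] -/
theorem radialSupport_radialTableOf (ℓ : ℕ) (Z : ℕ × ℕ → ℝ) : RadialSupport ℓ (radialTableOf ℓ Z) :=
  fun q hq => by
    unfold radialTableOf
    rw [if_neg (by omega)]

/-- **The constructed table has monomial array `Z`** whenever `Z` is symmetric and lives on the even total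
degrees `≥ 2ℓ` (the shape of every conversion array). [cite: HogervorstRychkov2013, §3 eqs. (3.4)–(3.6)] -/
theorem radialMonArr_radialTableOf {ℓ : ℕ} {Z : ℕ × ℕ → ℝ} (hZs : ∀ a b : ℕ, Z (b, a) = Z (a, b))
    (hZ0 : ∀ p : ℕ × ℕ, ¬ ((p.1 + p.2) % 2 = 0 ∧ 2 * ℓ ≤ p.1 + p.2) → Z p = 0) :
    radialMonArr ℓ (radialTableOf ℓ Z) = Z := by
  funext p
  unfold radialMonArr
  split_ifs with hp
  · obtain ⟨m, hm⟩ : ∃ m, p.1 + p.2 = 2 * (ℓ + m) := ⟨(p.1 + p.2) / 2 - ℓ, by omega⟩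
    have hN : (p.1 + p.2) / 2 = ℓ + m := by omega
    have hmem : p ∈ antidiagonal (2 * (ℓ + m)) := by rw [mem_antidiagonal]; exact hm
    have hex : ∃ c : ℕ → ℝ, ∀ p ∈ antidiagonal (2 * (ℓ + m)),
        ∑ j ∈ range (ℓ + m + 1), c j * radialArr (ℓ + m) j p = Z p :=
      exists_sum_radialArr_eq (ℓ + m) Z fun a b _ => hZs a b
    have hspec := Classical.epsilon_spec hex p hmem
    rw [hN, Nat.add_sub_cancel_left]
    rw [← hspec]
    refine Finset.sum_congr rfl fun j hj => ?_
    have hj' := Finset.mem_range.mp hj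
    unfold radialTableOf
    simp only
    rw [if_pos (by omega)]
  · exact (hZ0 p hp).symm

/-! ### §4. The radial table of the `⟨εσσε⟩` block -/

/-- **THE radial table of the prefactored `⟨εσσε⟩` block** `v^{s/2} g^{-s,s}_{Δ,ℓ}` (`s = Δσ - Δε`): the
supported table whose `(√ρ,√ρ̄)`-monomial array is the conversion `zRhoConv (s/2) Δ ℓ` of the Dolan–Osborn
array `A_{n,j}(s/2,s/2)/λ_ℓ` — Hogervorst–Rychkov's `B_{n,j}` / Costa–Hansen–Penedones–Trevisani's
`w(m,j)` for this block, as an explicit object of the tree (unique: `IsConformalBlock3D.radialTable_eq_radialTableAB`).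
[cite: CostaHansenPenedonesTrevisani2016, §2.1 eqs. (2.11), (2.15)] -/
noncomputable def radialTableAB (s Δ : ℝ) (ℓ : ℕ) : ℕ × ℕ → ℝ :=
  radialTableOf ℓ (zRhoConv (s / 2) Δ ℓ (fun q : ℕ × ℕ => hrCoeffAB (s / 2) (s / 2) Δ ℓ q.1 q.2 / legendreLam ℓ))

/-- `radialTableAB` is supported on `j ≤ ℓ + m`. [cite: CostaHansenPenedonesTrevisani2016, §2.1 eq. (2.15)] -/
theorem radialSupport_radialTableAB (s Δ : ℝ) (ℓ : ℕ) : RadialSupport ℓ (radialTableAB s Δ ℓ) :=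
  radialSupport_radialTableOf ℓ _

/-- **Its monomial array is the conversion array.** [cite: HogervorstRychkov2013, §3 "first method"] -/
theorem radialMonArr_radialTableAB (s Δ : ℝ) (ℓ : ℕ) :
    radialMonArr ℓ (radialTableAB s Δ ℓ) =
      zRhoConv (s / 2) Δ ℓ (fun q : ℕ × ℕ => hrCoeffAB (s / 2) (s / 2) Δ ℓ q.1 q.2 / legendreLam ℓ) := by
  refine radialMonArr_radialTableOf (fun a b => zRhoConv_swap _ _ _ _ a b) fun p hp => ?_
  obtain ⟨a, b⟩ := p
  simp only at hp
  by_cases h1 : (a + b) % 2 = 0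
  · exact zRhoConv_eq_zero_of_lt _ _ _ _ (by omega)
  · exact zRhoConv_eq_zero_of_odd_sum _ _ _ _ (by omega)

/-- **Uniqueness: every radial table of a typed `⟨εσσε⟩` block is `radialTableAB`.** At a regular `(Δ,ℓ)`
above the bound, if `g₂` satisfies `IsConformalBlock3D (-s) s Δ ℓ` and `HasRadialExpansion (s/2) Δ w g₂`
with `w` supported on `j ≤ ℓ + m`, then `w = radialTableAB s Δ ℓ` (lit-g5 identification + triangularity).
[cite: HogervorstRychkov2013, §3 "first method"] -/
theorem IsConformalBlock3D.radialTable_eq_radialTableAB {s Δ : ℝ} {ℓ : ℕ} {g₂ : ℝ → ℝ → ℝ}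
    {w : ℕ × ℕ → ℝ} (hΔ : unitarityBound3D ℓ < Δ) (hreg : ¬ accidentalDegeneracy3D Δ ℓ)
    (hg₂ : IsConformalBlock3D (-s) s Δ ℓ g₂) (hw : RadialSupport ℓ w)
    (hρ : HasRadialExpansion (s / 2) Δ w g₂) : w = radialTableAB s Δ ℓ :=
  hw.eq_of_radialMonArr_eq (radialSupport_radialTableAB s Δ ℓ)
    ((hg₂.radialMonArr_eq_zRhoConv hΔ hreg rfl hw hρ).trans (radialMonArr_radialTableAB s Δ ℓ).symm)

/-- **Non-negativity of the table ⇒ the typed `⟨εσσε⟩` block HAS the radial expansion on the whole square**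
(Vivanti–Pringsheim one variable at a time, `hasRadialExpansion_of_table_nonneg`; the `z`-side inputs are
the non-negative Dolan–Osborn array `A_{n,j}(s/2,s/2)/λ_ℓ` and the convergence of the `z`-series to `g₂`
on the square). [cite: HogervorstRychkov2013, §3.1] -/
theorem IsConformalBlock3D.hasRadialExpansion_of_radialTableAB_nonneg {s Δ : ℝ} {ℓ : ℕ}
    {g₂ : ℝ → ℝ → ℝ} (hΔ : unitarityBound3D ℓ < Δ) (hreg : ¬ accidentalDegeneracy3D Δ ℓ)
    (hg₂ : IsConformalBlock3D (-s) s Δ ℓ g₂) (hpos : ∀ q, 0 ≤ radialTableAB s Δ ℓ q) :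
    HasRadialExpansion (s / 2) Δ (radialTableAB s Δ ℓ) g₂ := by
  refine hasRadialExpansion_of_table_nonneg
    (A := fun q : ℕ × ℕ => hrCoeffAB (s / 2) (s / 2) Δ ℓ q.1 q.2 / legendreLam ℓ) (G := g₂)
    (fun q => div_nonneg (hrCoeffAB_self_nonneg _ hΔ _ _) (legendreLam_pos ℓ).le)
    (fun q hq => by simp only; rw [hrCoeffAB_eq_zero_of_lt _ _ _ hq, zero_div])
    (natCast_le_of_unitarityBound3D_lt hΔ) (fun x y hx hy => ?_) hpos
    (radialSupport_radialTableAB s Δ ℓ) (radialMonArr_radialTableAB s Δ ℓ)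
  have h := hg₂.hasSum_hrZTermAB hΔ hreg rfl hx hy
  exact h.congr_fun fun q => rfl

/-- **The radial block clause is EQUIVALENT to entrywise non-negativity of one explicit table.** At a
regular `(Δ, ℓ)` strictly above the unitarity bound:
`RadialPairClause Δσ Δε Δ ℓ ↔ ∀ (m,j), 0 ≤ radialTableAB (Δσ-Δε) Δ ℓ (m,j)`.
(`⇐`: existence of the `⟨εσσε⟩` expansion by Vivanti–Pringsheim, the signed `⟨σεσε⟩` expansion by
Dolan–Osborn (2.23) in the radial frame, `radialPairClause_of_hasRadialExpansion`; `⇒`: the clause's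
non-negative table is `radialTableAB` by uniqueness.) This is the precise content of "the coefficients of
the radial expansion are non-negative" (Hogervorst–Rychkov 2013 eq. (3.4): `B_{n,j} ≥ 0`;
Costa–Hansen–Penedones–Trevisani 2016 §2.1) as the ONLY input of the radial-frame odd sector beyond the
typed axioms. [cite: HogervorstRychkov2013, §3 eq. (3.4)] -/
theorem radialPairClause_iff_radialTableAB_nonneg {Δσ Δε Δ : ℝ} {ℓ : ℕ}
    (hΔ : unitarityBound3D ℓ < Δ) (hreg : ¬ accidentalDegeneracy3D Δ ℓ) :
    RadialPairClause Δσ Δε Δ ℓ ↔ ∀ q : ℕ × ℕ, 0 ≤ radialTableAB (Δσ - Δε) Δ ℓ q := by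
  constructor
  · intro h q
    have hg₁ := isConformalBlock3D_hrBlockAB (Δ₁₂ := Δσ - Δε) (Δ₃₄ := Δσ - Δε) hΔ hreg
    have hg₂ := isConformalBlock3D_hrBlockAB (Δ₁₂ := -(Δσ - Δε)) (Δ₃₄ := Δσ - Δε) hΔ hreg
    obtain ⟨wr, hw0, hws, -, hρ⟩ := h _ _ hg₁ hg₂
    rw [← hg₂.radialTable_eq_radialTableAB hΔ hreg hws hρ]
    exact hw0 q
  · intro hpos
    refine radialPairClause_of_hasRadialExpansion hΔ hreg fun g₂ hg₂ => ?_
    exact ⟨radialTableAB (Δσ - Δε) Δ ℓ, hpos, radialSupport_radialTableAB _ Δ ℓ,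
      hg₂.hasRadialExpansion_of_radialTableAB_nonneg hΔ hreg hpos⟩

end Literature.MathematicalPhysics.QuantumFieldTheory.ConformalBootstrap3D
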